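import Summits.Ventures.CertifiedManyBodySolver.Observables.StiffnessTLKineticCeiling
import Summits.Ventures.CertifiedManyBodySolver.Rows.DopedTLCorr
import Literature.MathematicalPhysics.QuantumLattice.HubbardKineticEnergyDensity
import HarnessLib

/-!
# Ventures/CertifiedManyBodySolver — Observables: the TL stiffness ceiling at the M3′ point
# (U = 8, n = 7/8, t′ = 0) as a CONSUMER OF KINETIC ROW CELLS — `M3CorrUpperRow/LowerRow` on the
# hopping window `{0, e₁, e₂}` ⇒ `ρ_s ≤ r/4`

HONEST FRAMING: one-sided certified CEILINGS on the flux stiffness (helicity modulus / superfluid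
weight); not a superconductivity verdict; no stiffness floor is obtainable from positivity + an energy
window (hubbard-obs-p2 STIFFNESS-SDP.md §4).

Cell `hubbard-obs` (D-0042), seat p2. Companion of `StiffnessTLKineticCeiling.lean` (p403426: the TL tower
`4ρ_s ≤ −k(ω)` on torus-limit states and the row adapter). This file pre-types, at the cell's anchor
A0′ = (8, 7/8, 0), the composition "typed kinetic ROW CELL ⇒ stiffness ceiling" so that a certified
thermodynamic-limit kinetic edge (e.g. the rung-0b `kinlo` edge on the EXT5-L⁺ relaxation, whose claim
node will be a `Rows/DopedTLCorr` cell on a hopping word) becomes a STIFFNESS row by one `exact`: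

* `m3_tp0_fluxStiffness_le_quarter_of_hopWindow_le` — hypothesis in WINDOW form: if for every torus limit
  `ω` of the M3′ class `Re ω_{\{0,e₁,e₂\}}(Σ_i Σ_σ (c†_{0σ}c_{e_iσ} + c†_{e_iσ}c_{0σ})) ≤ X` (this window
  expectation is `−k(ω) = ⟨−T⟩` per site, `re_expect_hoppingWindow_two`), then every uniform flux
  stiffness obeys `ρ_s ≤ X/4` (any membership proofs `h0`, `hi` may be used to write the word).
* `m3_tp0_fluxStiffness_le_of_hopWindow_upperRow` — CELL form: a typed `M3CorrUpperRow 0 u r {0,e₁,e₂} X_hop`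
  (`Re ω(X_hop) ≤ r` given `e₀ ≤ u`) together with a typed energy cap `M3EnergyUpperRow 0 hi`, `hi ≤ u`
  (e.g. #354 via `m3_tp0_upper_dbt299pair_allk_of`) gives `ρ_s ≤ r/4`.
* `m3_tp0_fluxStiffness_le_of_negHopWindow_lowerRow` — the same for a LOWER cell on the negated word
  `−X_hop` (whose expectation is `+k(ω)`, the sign convention of a "kin lo" objective): `r ≤ Re ω(−X_hop)`
  gives `ρ_s ≤ −r/4`.

Bar to beat (registry rows 5–6, `OBS.kin/rhos.tp0.TLchord354x426`): `X < 906213886029816052260099/2⁷⁹ ≈ 1.4992051`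
⇔ `ρ_s < 0.3748013` (tree units; Hazra–Verma–Randeria `D_s = ρ_s/2`, Scalapino–White–Zhang `D/(πe²) = 2ρ_s`).
Two-row (form-W, `le ∧ ge`) cells of `Rows/DopedTLCorrWindow.lean` reduce to the window form by their own
`uncond` theorem and then to `m3_tp0_fluxStiffness_le_quarter_of_hopWindow_le`. No `sorry`, no definitions,
no new facts, zero computation.
References: [ScalapinoWhiteZhang1993] §II; [HazraVermaRanderia2019] eqs. (2)–(4); [BratteliRobinsonII1997] §6.2.4.
-/

noncomputable section

namespace Summit.Ventures.CertifiedManyBodySolver.Observables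

open Matrix Finset Filter Topology
open Literature.MathematicalPhysics.QuantumLattice
open Literature.MathematicalPhysics.QuantumLattice.ThermodynamicLimit
open Literature.MathematicalPhysics.QuantumFieldTheory
open Literature.Probability.LatticeModels
open scoped ComplexOrder ComplexConjugate Topology

/-- **Window form of the M3′ hook.** If for every torus limit `ω` of unit `(rectN (7/8) L, S^z = 0)`-sector
ground states of `hubbardTorusTT' L 1 0 8` along sides `L_j → ∞` the hopping-window expectation satisfies
`Re ω_{\{0,e₁,e₂\}}(Σ_i Σ_σ (c†_{0σ}c_{e_iσ} + c†_{e_iσ}c_{0σ})) ≤ X` (`= ⟨−T⟩` per site of `ω`), then every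
uniform flux stiffness `ρ_s > 0` (scale `θ₀ > 0`, all even `L ≥ L₀`) of the zero-flux `(N_L, 0)` sectors of
`hubbardTorus 2 L 1 8` at density `7/8` obeys `ρ_s ≤ X/4` (`re_expect_hoppingWindow_two` + the row adapter
`fluxStiffness_le_of_torusLimit_kineticDensity_ge_TT'zero` at `U = 8`, `δ = 1/8`). Any membership proofs
`h0`, `hi` may be used to spell the word. HONEST FRAMING: one-sided ceiling; not a superconductivity verdict.
[cite: ScalapinoWhiteZhang1993, §II] -/
theorem m3_tp0_fluxStiffness_le_quarter_of_hopWindow_le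
    (h0 : (0 : Site 2) ∈ ({0, unitVec 0, unitVec 1} : Finset (Site 2)))
    (hi : ∀ i : Fin 2, unitVec i ∈ ({0, unitVec 0, unitVec 1} : Finset (Site 2))) (X : ℝ)
    (hrow : ∀ (ω : InfVolFermionState 2) (Ls : ℕ → ℕ) (ψ : ∀ L, Fock (Orb (FermionTorus 2 L))),
      Tendsto Ls atTop atTop →
      (∀ j, IsGroundStateInSector (hubbardTorusTT' (Ls j) 1 0 8) (rectN (7 / 8) (Ls j)) 0 (ψ (Ls j))) →
      (∀ j, star (ψ (Ls j)) ⬝ᵥ ψ (Ls j) = 1) → ω.IsTorusLimitOf ψ Ls →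
      (ω.expect ({0, unitVec 0, unitVec 1} : Finset (Site 2))
        (∑ i : Fin 2, ∑ σ : Fin 2,
          ((cAt 0 h0 σ)ᴴ * cAt (unitVec i) (hi i) σ + (cAt (unitVec i) (hi i) σ)ᴴ * cAt 0 h0 σ))).re ≤ X) :
    ∀ (ρs θ₀ : ℝ), 0 < ρs → 0 < θ₀ → ∀ L₀ : ℕ,
      (∀ (L : ℕ) [NeZero L], L₀ ≤ L → Even L →
        ∀ θ : ℝ, |θ| ≤ θ₀ → ρs * θ ^ 2 ≤ fluxEnergy L 8 (1 / 8) θ - fluxEnergy L 8 (1 / 8) 0) →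
      ρs ≤ X / 4 := by
  intro ρs θ₀ hρs hθ₀ L₀ hst
  have h := fluxStiffness_le_of_torusLimit_kineticDensity_ge_TT'zero (U := 8) (δ := 1 / 8) (K := -X)
    (by norm_num) hρs hθ₀ hst ?_
  · linarith
  intro ω Ls ψ hLs hψ h1 hω
  have hψ' : ∀ j, IsGroundStateInSector (hubbardTorusTT' (Ls j) 1 0 8) (rectN (7 / 8) (Ls j)) 0 (ψ (Ls j)) :=
    fun j => by
      have h := hψ j
      rw [show (1 - 1 / 8 : ℝ) = 7 / 8 by norm_num] at h
      exact h
  have hX := hrow ω Ls ψ hLs hψ' h1 hω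
  have hwin := InfVolFermionState.re_expect_hoppingWindow_two ω
  -- the bond-by-bond kinetic density is minus the window expectation
  have hk : (∑ i : Fin 2, -(1 : ℝ) * ∑ σ : Fin 2,
        ((ω.expect {0, 0 + unitVec i}
            ((cAt 0 (mem_insert_self _ _) σ)ᴴ *
              cAt (0 + unitVec i) (mem_insert_of_mem (mem_singleton_self _)) σ)).re +
          (ω.expect {0, 0 + unitVec i}
            ((cAt (0 + unitVec i) (mem_insert_of_mem (mem_singleton_self _)) σ)ᴴ *
              cAt 0 (mem_insert_self _ _) σ)).re)) =
      -(ω.expect ({0, unitVec 0, unitVec 1} : Finset (Site 2))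
        (∑ i : Fin 2, ∑ σ : Fin 2,
          ((cAt 0 h0 σ)ᴴ * cAt (unitVec i) (hi i) σ + (cAt (unitVec i) (hi i) σ)ᴴ * cAt 0 h0 σ))).re := by
    rw [hwin, ← Finset.sum_neg_distrib]
    refine Finset.sum_congr rfl fun i _ => ?_
    ring
  rw [hk]
  linarith

/-- **Cell form (UPPER cell on the hopping-window word).** A typed `M3CorrUpperRow 0 u r {0,e₁,e₂} X_hop`
(`Re ω(X_hop) ≤ r` for every torus limit of the M3′ class, given `e₀(8, 7/8, 0) ≤ u`), discharged by a typed
energy cap `M3EnergyUpperRow 0 hi` with `hi ≤ u` (e.g. CERTIFIED #354 via `m3_tp0_upper_dbt299pair_allk_of`),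
gives `ρ_s ≤ r/4` for every uniform flux stiffness at `(8, 7/8, 0)`. [cite: ScalapinoWhiteZhang1993, §II] -/
theorem m3_tp0_fluxStiffness_le_of_hopWindow_upperRow
    (h0 : (0 : Site 2) ∈ ({0, unitVec 0, unitVec 1} : Finset (Site 2)))
    (hi : ∀ i : Fin 2, unitVec i ∈ ({0, unitVec 0, unitVec 1} : Finset (Site 2))) {u r hi' : ℚ}
    (h : M3CorrUpperRow 0 u r ({0, unitVec 0, unitVec 1} : Finset (Site 2))
      (∑ i : Fin 2, ∑ σ : Fin 2,
        ((cAt 0 h0 σ)ᴴ * cAt (unitVec i) (hi i) σ + (cAt (unitVec i) (hi i) σ)ᴴ * cAt 0 h0 σ)))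
    (hE : M3EnergyUpperRow 0 hi') (hhi : hi' ≤ u) :
    ∀ (ρs θ₀ : ℝ), 0 < ρs → 0 < θ₀ → ∀ L₀ : ℕ,
      (∀ (L : ℕ) [NeZero L], L₀ ≤ L → Even L →
        ∀ θ : ℝ, |θ| ≤ θ₀ → ρs * θ ^ 2 ≤ fluxEnergy L 8 (1 / 8) θ - fluxEnergy L 8 (1 / 8) 0) →
      ρs ≤ ((r : ℚ) : ℝ) / 4 :=
  m3_tp0_fluxStiffness_le_quarter_of_hopWindow_le h0 hi _ fun ω Ls ψ hLs hψ h1 hω =>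
    M3CorrUpperRow.uncond h hE hhi ω Ls ψ hLs hψ h1 hω

/-- **Cell form (LOWER cell on the NEGATED hopping-window word** — the sign convention of a "kinetic lo"
objective, whose expectation is the kinetic energy density `k(ω) ≤ 0` itself). A typed
`M3CorrLowerRow 0 u r {0,e₁,e₂} (−X_hop)` (`r ≤ Re ω(−X_hop) = k(ω)`), discharged by a typed energy cap
`M3EnergyUpperRow 0 hi` with `hi ≤ u`, gives `ρ_s ≤ −r/4` for every uniform flux stiffness at `(8, 7/8, 0)`.
[cite: ScalapinoWhiteZhang1993, §II] -/
theorem m3_tp0_fluxStiffness_le_of_negHopWindow_lowerRow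
    (h0 : (0 : Site 2) ∈ ({0, unitVec 0, unitVec 1} : Finset (Site 2)))
    (hi : ∀ i : Fin 2, unitVec i ∈ ({0, unitVec 0, unitVec 1} : Finset (Site 2))) {u r hi' : ℚ}
    (h : M3CorrLowerRow 0 u r ({0, unitVec 0, unitVec 1} : Finset (Site 2))
      (-(∑ i : Fin 2, ∑ σ : Fin 2,
        ((cAt 0 h0 σ)ᴴ * cAt (unitVec i) (hi i) σ + (cAt (unitVec i) (hi i) σ)ᴴ * cAt 0 h0 σ))))
    (hE : M3EnergyUpperRow 0 hi') (hhi : hi' ≤ u) :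
    ∀ (ρs θ₀ : ℝ), 0 < ρs → 0 < θ₀ → ∀ L₀ : ℕ,
      (∀ (L : ℕ) [NeZero L], L₀ ≤ L → Even L →
        ∀ θ : ℝ, |θ| ≤ θ₀ → ρs * θ ^ 2 ≤ fluxEnergy L 8 (1 / 8) θ - fluxEnergy L 8 (1 / 8) 0) →
      ρs ≤ -((r : ℚ) : ℝ) / 4 := by
  refine m3_tp0_fluxStiffness_le_quarter_of_hopWindow_le h0 hi _ fun ω Ls ψ hLs hψ h1 hω => ?_
  have hh := M3CorrLowerRow.uncond h hE hhi ω Ls ψ hLs hψ h1 hω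
  rw [map_neg, Complex.neg_re] at hh
  linarith

end Summit.Ventures.CertifiedManyBodySolver.Observables

end
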